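import Summits.BirchSwinnertonDyer.BirchSwinnertonDyer.Theorems.ResidualThetaTransportAtTwoDefs
import Summits.BirchSwinnertonDyer.BirchSwinnertonDyer.Theorems.ResidualThetaTransportAtTwoResidualSignedLambdaLowerCMAtTwoIntDescent
import Summits.BirchSwinnertonDyer.BirchSwinnertonDyer.Theorems.ResidualThetaTransportAtTwoResidualSignedLambdaLowerCMAtTwoDualityGlue
import Summits.BirchSwinnertonDyer.BirchSwinnertonDyer.Theorems.ResidualThetaTransportAtTwoResidualSignedLambdaLowerCMAtTwoLambdaAssembly
import HarnessLib

/-!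
# Station (DESC) of the KZ_g (i)-half, PROVED: the two-currency descent `λ_{ℤ₂}(ℤ₂⟦X⟧ⁿ ⧸ 𝒸(Λ_𝒪 z)) = f · λ_𝒪(Λ_𝒪 ⧸ (h))`
# along a column identity `e (𝒸 (r • z)) = r * h`

Route `ResidualThetaTransportAtTwo` (RTT), crux RSL_g `ResidualSignedLambdaLowerCMAtTwo` (stmt-BirchSwinnertonDyer-22608), line `onepair`;
hold-opening of KZ_g (stmt-BirchSwinnertonDyer-24105), (i)-half interior. Seat `bsd-wall-tp2-p2x-w2` g21 (width seat; `--supports`, closes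
nothing). THEOREMS ONLY (no definition, no named fact, no instance, no `sorry`). BSD is not proved by any of this; RSL_g / KZ_g stay OPEN.

WHAT. The landed kernel of the (i)-half, `ThetaTransport.S3BodyOfStations.s3body_of_stations` (p717288), takes the two-currency descent as a
STATION hypothesis
`hDesc : ∀ (z : I.H) (h : Λ_𝒪), h ≠ 0 → (∀ r, e (π.cvec (r • z)) = r * h) → Module.Finite ℚ₂ (ℚ₂ ⊗ π.colocdQuot z) ∧ π.f * λ_𝒪(Λ_𝒪 ⧸ (h)) ≤ λ_{ℤ₂}(π.colocdQuot z)`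
(k2-g18 PLAN 1 `iD_count`; LEAD rtt-p2 g20's v3f station `stub_kzgDescent`). THIS FILE PROVES IT for every additive trivialisation
`e : ℤ₂⟦X⟧ⁿ ≃+ Λ_𝒪` that is `ℤ₂⟦X⟧`-semilinear through `map ι` (the first clause of station (E), k3-g19 `PriceNode.exists_trivialisation`),
with EQUALITY: `λ_{ℤ₂}(π.colocdQuot z) = π.f · λ_𝒪(Λ_𝒪 ⧸ (h))`.

HOW (landed lemmas only).
* §1 `lamTwo_eq_mul_lamO` / `finite_baseChange_padic_iff`: for ANY `𝒪`-module `M` whose `ℤ_p`-structure is the restriction along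
  `ι = padicIntToCoeffIntegers S`, `λ_{ℤ_p}(M) = f · λ_𝒪(M)` and `ℚ_p ⊗_{ℤ_p} M` finite ⇔ `Frac 𝒪 ⊗_𝒪 M` finite, `f` read off an additive
  `ℤ_p`-basis `B : ℤ_p^f ≃+ 𝒪` (the pin `π.B`) — G1d/G1b `CharIdealLambda.IntDescent.finrank_baseChange_eq_finrank_mul` / `finite_baseChange_iff`
  (p-file `…IntDescent`), exactly as in `LambdaLowerBoundO.le_finrank_characterModule_of_intDualityData` §2.
* §2 `isTorsion_quotient_span_singleton`, `finite_baseChange_quotient_span_singleton` (`h ≠ 0` ⇒ `Λ_𝒪 ⧸ (h)` torsion ⇒ `Frac 𝒪 ⊗` finite, by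
  `CharIdealLambda.finite_baseChange_of_isTorsion`).
* §3 the transport: `e` is `ℤ₂`-linear (`c • t = C c • t`, `map ι (C c) = C (ι c)`), carries `N := span_{ℤ₂⟦X⟧} 𝒸(Λ_𝒪 z)` ONTO the ideal `(h)`
  (`⊆` by span induction with `e (s • x) = map ι s * e x`; `⊇` since every `r * h` is `e (𝒸 (r • z))`), so
  `CharIdealLambda.finrank_baseChange_quotient_eq_of_map_eq` / `…restrictScalars_eq` (p-file `…DualityGlue`) give
  `λ_{ℤ₂}(π.colocdQuot z) = λ_{ℤ₂}(Λ_𝒪 ⧸ (h))`; then §1. Main: **`lamTwo_colocdQuot_eq_of_column`**, **`desc_of_column`**, **`desc_station`**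
  (the `hDesc` binder of `s3body_of_stations` VERBATIM, universally in `z, h`).

References: [Kato2004Asterisque] Thm. 12.5 (1) (p. 222), §13.8 (p. 228); [Washington1997] §13.2; [Kobayashi2003] Thm. 7.3.
-/

set_option autoImplicit false
-- the Theorems namespace of this sub repeats the summit name by design (D-0017 nested layout)
set_option linter.dupNamespace false

noncomputable section

open scoped TensorProduct Classical nonZeroDivisors

namespace Summit.BirchSwinnertonDyer.BirchSwinnertonDyer.Theorems.ThetaTransport.TwoCurrencyDescent

open Literature.NumberTheory.EllipticCurves Literature.NumberTheory.EllipticCurves.GreenbergSelmer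
open Literature.NumberTheory.GaloisRepresentations NumberField IsDedekindDomain Field
open Summit.BirchSwinnertonDyer.BirchSwinnertonDyer.Theorems
open Summit.BirchSwinnertonDyer.BirchSwinnertonDyer.Theorems.OnePair

universe u

/-! ## §1 `λ_{ℤ_p} = f · λ_𝒪` for an `𝒪`-module with the restricted `ℤ_p`-structure -/

section Currency

variable {p : ℕ} [Fact p.Prime] (S : Set (PadicAlgCl p)) {f : ℕ}

/-- **`λ_{ℤ_p}(M) = f · λ_𝒪(M)` and the finiteness transfer**, for ANY `𝒪`-module `M` (`𝒪 = padicCoeffIntegers S`) carrying the `ℤ_p`-structure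
restricted along `ι = padicIntToCoeffIntegers S` (`c • m = ι c • m`), where `f` is the `ℤ_p`-rank of `𝒪` witnessed by an additive, `ℤ_p`-semilinear
basis `B : ℤ_p^f ≃+ 𝒪` (the pin `π.B`): both `ℚ_p ⊗_{ℤ_p} M` and `Frac 𝒪 ⊗_𝒪 M` are localisations of `M` at `ℤ_p ∖ 0`, and `[Frac 𝒪 : ℚ_p] = f`.
[cite: Washington1997, §13.2] [cite: Kato2004Asterisque, §13.8 (p. 228)] -/
theorem lamTwo_eq_mul_lamO_and_finite_iff (B : (Fin f → ℤ_[p]) ≃+ coeffO S)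
    (hB : ∀ (c : ℤ_[p]) (y : Fin f → ℤ_[p]), B (c • y) = padicIntToCoeffIntegers S c * B y)
    (M : Type u) [AddCommGroup M] [Module (coeffO S) M] [Module ℤ_[p] M]
    (hsm : ∀ (c : ℤ_[p]) (m : M), c • m = padicIntToCoeffIntegers S c • m) :
    lamTwo p M = f * lamO S M ∧
      (Module.Finite ℚ_[p] (ℚ_[p] ⊗[ℤ_[p]] M) ↔
        Module.Finite (FractionRing (coeffO S)) ((FractionRing (coeffO S)) ⊗[coeffO S] M)) := by
  -- the `ℤ_p`-algebra structure of `𝒪` through `ι` (local; the tree carries none for `padicCoeffIntegers S`)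
  letI ialg : Algebra ℤ_[p] (coeffO S) := (padicIntToCoeffIntegers S).toAlgebra
  have halg : ∀ c : ℤ_[p], algebraMap ℤ_[p] (coeffO S) c = padicIntToCoeffIntegers S c := fun _ ↦ rfl
  have hinj : Function.Injective (padicIntToCoeffIntegers S) := fun a b h ↦ by
    have h' := congrArg (fun x : coeffO S ↦ (x : PadicAlgCl p)) h
    simp only [coe_padicIntToCoeffIntegers] at h'
    exact Subtype.ext ((algebraMap ℚ_[p] (PadicAlgCl p)).injective h')
  haveI : FaithfulSMul ℤ_[p] (coeffO S) := (faithfulSMul_iff_algebraMap_injective ℤ_[p] _).2 hinj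
  -- `𝒪` is free of rank `f` over `ℤ_p`
  let Bₗ : (Fin f → ℤ_[p]) ≃ₗ[ℤ_[p]] coeffO S :=
    { B with map_smul' := fun c y ↦ by rw [AddEquiv.toFun_eq_coe, hB, RingHom.id_apply, Algebra.smul_def, halg] }
  haveI : Module.Free ℤ_[p] (coeffO S) := Module.Free.of_equiv Bₗ
  haveI : Module.Finite ℤ_[p] (coeffO S) := Module.Finite.equiv Bₗ
  have hf : Module.finrank ℤ_[p] (coeffO S) = f := by rw [← Bₗ.finrank_eq, Module.finrank_fin_fun]
  haveI : Algebra.IsAlgebraic ℤ_[p] (coeffO S) := Algebra.IsAlgebraic.of_finite ℤ_[p] _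
  -- the scalar tower `ℤ_p → 𝒪 → M` from `hsm`
  haveI : IsScalarTower ℤ_[p] (coeffO S) M :=
    ⟨fun c a m ↦ by rw [Algebra.smul_def, halg, mul_smul, ← hsm]⟩
  -- `ℚ_p → Frac 𝒪`
  set Kf := FractionRing (coeffO S) with hKf
  have hinjK : Function.Injective (algebraMap ℤ_[p] Kf) := by
    rw [IsScalarTower.algebraMap_eq ℤ_[p] (coeffO S) Kf]
    exact (IsFractionRing.injective (coeffO S) Kf).comp hinj
  letI : Algebra ℚ_[p] Kf := (IsFractionRing.lift hinjK : ℚ_[p] →+* Kf).toAlgebra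
  haveI : IsScalarTower ℤ_[p] ℚ_[p] Kf :=
    IsScalarTower.of_algebraMap_eq fun z ↦ (IsFractionRing.lift_algebraMap hinjK z).symm
  haveI : FiniteDimensional ℚ_[p] Kf :=
    CharIdealLambda.IntDescent.finiteDimensional_fractionField (R := ℤ_[p]) (A := coeffO S) ℚ_[p] Kf
  refine ⟨?_, CharIdealLambda.IntDescent.finite_baseChange_iff (R := ℤ_[p]) (A := coeffO S) ℚ_[p] Kf (M := M)⟩
  rw [lamTwo_eq, lamO_eq, CharIdealLambda.IntDescent.finrank_baseChange_eq_finrank_mul (R := ℤ_[p]) (A := coeffO S) ℚ_[p] Kf (M := M), hf]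

/-- **`λ_{ℤ_p}(M) = f · λ_𝒪(M)`** (first clause of `lamTwo_eq_mul_lamO_and_finite_iff`). [cite: Washington1997, §13.2] -/
theorem lamTwo_eq_mul_lamO (B : (Fin f → ℤ_[p]) ≃+ coeffO S)
    (hB : ∀ (c : ℤ_[p]) (y : Fin f → ℤ_[p]), B (c • y) = padicIntToCoeffIntegers S c * B y)
    (M : Type u) [AddCommGroup M] [Module (coeffO S) M] [Module ℤ_[p] M]
    (hsm : ∀ (c : ℤ_[p]) (m : M), c • m = padicIntToCoeffIntegers S c • m) :
    lamTwo p M = f * lamO S M :=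
  (lamTwo_eq_mul_lamO_and_finite_iff S B hB M hsm).1

/-- **`ℚ_p ⊗_{ℤ_p} M` finite ⇔ `Frac 𝒪 ⊗_𝒪 M` finite** (second clause of `lamTwo_eq_mul_lamO_and_finite_iff`). [cite: Washington1997, §13.2] -/
theorem finite_baseChange_padic_iff (B : (Fin f → ℤ_[p]) ≃+ coeffO S)
    (hB : ∀ (c : ℤ_[p]) (y : Fin f → ℤ_[p]), B (c • y) = padicIntToCoeffIntegers S c * B y)
    (M : Type u) [AddCommGroup M] [Module (coeffO S) M] [Module ℤ_[p] M]
    (hsm : ∀ (c : ℤ_[p]) (m : M), c • m = padicIntToCoeffIntegers S c • m) :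
    Module.Finite ℚ_[p] (ℚ_[p] ⊗[ℤ_[p]] M) ↔
      Module.Finite (FractionRing (coeffO S)) ((FractionRing (coeffO S)) ⊗[coeffO S] M) :=
  (lamTwo_eq_mul_lamO_and_finite_iff S B hB M hsm).2

end Currency

/-! ## §2 `Λ_𝒪 ⧸ (h)` for `h ≠ 0`: torsion, hence `λ`-finite -/

section Quot

variable {A : Type u} [CommRing A] [IsDomain A]

/-- `Λ ⧸ (h)` is a torsion `Λ`-module for `h ∈ Λ ∖ 0`, `Λ = A⟦X⟧` a domain. [cite: Washington1997, §13.2] -/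
theorem isTorsion_quotient_span_singleton {h : PowerSeries A} (hh : h ≠ 0) :
    Module.IsTorsion (PowerSeries A) (PowerSeries A ⧸ Ideal.span {h}) := by
  intro x
  refine ⟨⟨h, mem_nonZeroDivisors_of_ne_zero hh⟩, ?_⟩
  obtain ⟨y, rfl⟩ := Submodule.Quotient.mk_surjective (Ideal.span {h}) x
  rw [Submonoid.mk_smul, ← Submodule.Quotient.mk_smul, Submodule.Quotient.mk_eq_zero, smul_eq_mul, mul_comm]
  exact Ideal.mem_span_singleton'.mpr ⟨y, rfl⟩

/-- **`Frac A ⊗_A Λ ⧸ (h)` is finite-dimensional** for `h ≠ 0` (`A` a complete DVR): a cyclic torsion `Λ`-module.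
[cite: Washington1997, §13.2 (Thm. 13.12, Prop. 13.8)] -/
theorem finite_baseChange_quotient_span_singleton [IsDiscreteValuationRing A] [IsAdicComplete (IsLocalRing.maximalIdeal A) A]
    (K : Type u) [Field K] [Algebra A K] [IsFractionRing A K] {h : PowerSeries A} (hh : h ≠ 0) :
    Module.Finite K (K ⊗[A] (PowerSeries A ⧸ Ideal.span {h})) :=
  CharIdealLambda.finite_baseChange_of_isTorsion K (PowerSeries A ⧸ Ideal.span {h}) (isTorsion_quotient_span_singleton hh)

end Quot

/-! ## §3 The transport along `e` and station (DESC) -/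

section Desc

variable {S : Set (PadicAlgCl 2)} {W : WeierstrassCurve ℚ} [W.IsElliptic] {κ : ZpExtension ℚ 2} {γ : absoluteGaloisGroup ℚ}
  {S₀ : Finset (HeightOneSpectrum (𝓞 ℚ))} {n : ℕ} {ρ : FramedGaloisRep ℚ ↥(padicCoeffIntegers S) 2}
  {Θ : ∀ v : HeightOneSpectrum (𝓞 ℚ), ((2 : ℕ) : 𝓞 ℚ) ∈ v.asIdeal → (Cofree ρ ↥(padicCoeffField S) ≃+ (Fin n → ↥(W.geomPrimaryTorsion 2)))}
  {hΘ : ∀ v hv (δ : absoluteGaloisGroup (v.adicCompletion ℚ)) m i,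
    Θ v hv (resGalOfEmb (closureEmb (K := ℚ) (v.adicCompletion ℚ)) δ • m) i = resGalOfEmb (closureEmb (K := ℚ) (v.adicCompletion ℚ)) δ • Θ v hv m i}
  {I : Kato2004.IwasawaH1DataCoeff (FramedGaloisRep.toGaloisRep ρ) 2 κ γ}
  {Sg : AddSubgroup (subgroupH1 κ.kerSubgroup (Cofree ρ ↥(padicCoeffField S)))} [Module ↥(padicCoeffIntegers S) ↥Sg]

/-- **THE TRANSPORT + TWO-CURRENCY COUNT (PROVED): `λ_{ℤ₂}(ℤ₂⟦X⟧ⁿ ⧸ span 𝒸(Λ_𝒪 z)) = f · λ_𝒪(Λ_𝒪 ⧸ (h))`, and `ℚ₂ ⊗ (ℤ₂⟦X⟧ⁿ ⧸ span 𝒸(Λ_𝒪 z))`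
is finite-dimensional**, for a pin bundle `π`, an additive `e : ℤ₂⟦X⟧ⁿ ≃+ Λ_𝒪` that is `ℤ₂⟦X⟧`-semilinear through `map ι`, and a class `z` with
the column identity `e (𝒸 (r • z)) = r * h`, `h ≠ 0`. [cite: Kato2004Asterisque, Thm. 12.5 (1) (p. 222), §13.8 (p. 228)] [cite: Washington1997, §13.2] -/
theorem lamTwo_colocdQuot_eq_of_column [IsDiscreteValuationRing (coeffO S)] [IsAdicComplete (IsLocalRing.maximalIdeal (coeffO S)) (coeffO S)]
    (π : OnePairPins S W κ γ S₀ n ρ Θ hΘ I Sg) (e : (Fin n → PowerSeries ℤ_[2]) ≃+ IwasawaAlgebraO S)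
    (he : ∀ (r : PowerSeries ℤ_[2]) (t : Fin n → PowerSeries ℤ_[2]), e (r • t) = PowerSeries.map (padicIntToCoeffIntegers S) r * e t)
    (z : I.H) (h : IwasawaAlgebraO S) (hh : h ≠ 0) (hcol : ∀ r : IwasawaAlgebraO S, e (π.cvec (r • z)) = r * h) :
    Module.Finite ℚ_[2] (ℚ_[2] ⊗[ℤ_[2]] π.colocdQuot z) ∧
      lamTwo 2 (π.colocdQuot z) = π.f * lamO S (IwasawaAlgebraO S ⧸ Ideal.span {h}) := by
  -- the `ℤ₂`-algebra structure of `𝒪` through `ι` (local), hence of `Λ_𝒪` and of `Λ_𝒪 ⧸ (h)`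
  letI ialg : Algebra ℤ_[2] (coeffO S) := (padicIntToCoeffIntegers S).toAlgebra
  have halg : ∀ c : ℤ_[2], algebraMap ℤ_[2] (coeffO S) c = padicIntToCoeffIntegers S c := fun _ ↦ rfl
  -- the `ℤ₂`-structure of `Λ_𝒪 ⧸ (h)` is the restriction of its `𝒪`-structure
  have hsm : ∀ (c : ℤ_[2]) (m : IwasawaAlgebraO S ⧸ Ideal.span {h}), c • m = padicIntToCoeffIntegers S c • m :=
    fun c m ↦ by rw [← halg, algebraMap_smul]
  -- `e` is `ℤ₂`-linear
  let eₗ : (Fin n → PowerSeries ℤ_[2]) ≃ₗ[ℤ_[2]] IwasawaAlgebraO S :=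
    { e with
      map_smul' := fun c t ↦ by
        rw [AddEquiv.toFun_eq_coe, RingHom.id_apply]
        have h1 : c • t = (PowerSeries.C c : PowerSeries ℤ_[2]) • t := by
          funext i
          simp only [Pi.smul_apply, smul_eq_mul, PowerSeries.smul_eq_C_mul]
        rw [h1, he, PowerSeries.map_C, Algebra.smul_def, PowerSeries.algebraMap_apply, halg] }
  have heₗ : ∀ t, eₗ t = e t := fun _ ↦ rfl
  -- `e` carries `N := span_{ℤ₂⟦X⟧} 𝒸(Λ_𝒪 z)` onto the ideal `(h)`
  set N : Submodule (PowerSeries ℤ_[2]) (Fin n → PowerSeries ℤ_[2]) :=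
    Submodule.span (PowerSeries ℤ_[2]) (π.cvec '' (↑(Submodule.span (IwasawaAlgebraO S) ({z} : Set I.H)) : Set I.H)) with hN
  have hmap : (N.restrictScalars ℤ_[2]).map (eₗ : (Fin n → PowerSeries ℤ_[2]) →ₗ[ℤ_[2]] IwasawaAlgebraO S) =
      (Ideal.span {h} : Submodule (IwasawaAlgebraO S) (IwasawaAlgebraO S)).restrictScalars ℤ_[2] := by
    refine le_antisymm ?_ ?_
    · rintro _ ⟨x, hx, rfl⟩
      have hx' : x ∈ N := hx
      clear hx
      change e x ∈ Ideal.span {h}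
      induction hx' using Submodule.span_induction with
      | mem y hy =>
        obtain ⟨x', hx', rfl⟩ := hy
        obtain ⟨r, rfl⟩ := Submodule.mem_span_singleton.mp hx'
        rw [hcol]
        exact Ideal.mul_mem_left _ r (Ideal.mem_span_singleton_self h)
      | zero => rw [map_zero]; exact zero_mem _
      | add x y _ _ hx hy => rw [map_add]; exact add_mem hx hy
      | smul s x _ hx => rw [he]; exact Ideal.mul_mem_left _ _ hx
    · intro w hw
      obtain ⟨r, rfl⟩ := Ideal.mem_span_singleton'.mp hw
      refine ⟨π.cvec (r • z), ?_, hcol r⟩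
      exact Submodule.subset_span ⟨r • z, Submodule.smul_mem _ r (Submodule.mem_span_singleton_self z), rfl⟩
  -- finiteness: `Frac 𝒪 ⊗ Λ_𝒪/(h)` finite ⟹ `ℚ₂ ⊗ Λ_𝒪/(h)` finite ⟹ transport
  have hfinO : Module.Finite (FractionRing (coeffO S)) ((FractionRing (coeffO S)) ⊗[coeffO S] (IwasawaAlgebraO S ⧸ Ideal.span {h})) :=
    finite_baseChange_quotient_span_singleton (FractionRing (coeffO S)) hh
  have hfin₂ : Module.Finite ℚ_[2] (ℚ_[2] ⊗[ℤ_[2]] (IwasawaAlgebraO S ⧸ Ideal.span {h})) :=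
    (finite_baseChange_padic_iff S π.B π.hB (IwasawaAlgebraO S ⧸ Ideal.span {h}) hsm).mpr hfinO
  have hfinN : Module.Finite ℚ_[2] (ℚ_[2] ⊗[ℤ_[2]] ((Fin n → PowerSeries ℤ_[2]) ⧸ N.restrictScalars ℤ_[2])) :=
    (CharIdealLambda.finite_baseChange_quotient_iff_of_map_eq ℚ_[2] eₗ (N.restrictScalars ℤ_[2]) (Ideal.span {h}) hmap).mpr hfin₂
  refine ⟨(CharIdealLambda.finite_baseChange_quotient_restrictScalars_iff ℚ_[2] N).mp hfinN, ?_⟩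
  -- the count: `λ_{ℤ₂}(Λⁿ/N) = λ_{ℤ₂}(Λⁿ/N|_{ℤ₂}) = λ_{ℤ₂}(Λ_𝒪/(h)) = f · λ_𝒪(Λ_𝒪/(h))`
  rw [lamTwo_eq, ← CharIdealLambda.finrank_baseChange_quotient_restrictScalars_eq ℚ_[2] N,
    CharIdealLambda.finrank_baseChange_quotient_eq_of_map_eq ℚ_[2] eₗ (N.restrictScalars ℤ_[2]) (Ideal.span {h}) hmap, ← lamTwo_eq]
  exact lamTwo_eq_mul_lamO S π.B π.hB (IwasawaAlgebraO S ⧸ Ideal.span {h}) hsm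

/-- **Station (DESC), PROVED** — the two-currency descent along a column identity, in the currency of the `hDesc` binder of
`S3BodyOfStations.s3body_of_stations`: `Module.Finite ℚ₂ (ℚ₂ ⊗ π.colocdQuot z) ∧ π.f · λ_𝒪(Λ_𝒪 ⧸ (h)) ≤ λ_{ℤ₂}(π.colocdQuot z)` (with equality,
`lamTwo_colocdQuot_eq_of_column`). [cite: Kato2004Asterisque, Thm. 12.5 (1) (p. 222), §13.8 (p. 228)] [cite: Washington1997, §13.2] -/
theorem desc_of_column [IsDiscreteValuationRing (coeffO S)] [IsAdicComplete (IsLocalRing.maximalIdeal (coeffO S)) (coeffO S)]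
    (π : OnePairPins S W κ γ S₀ n ρ Θ hΘ I Sg) (e : (Fin n → PowerSeries ℤ_[2]) ≃+ IwasawaAlgebraO S)
    (he : ∀ (r : PowerSeries ℤ_[2]) (t : Fin n → PowerSeries ℤ_[2]), e (r • t) = PowerSeries.map (padicIntToCoeffIntegers S) r * e t)
    (z : I.H) (h : IwasawaAlgebraO S) (hh : h ≠ 0) (hcol : ∀ r : IwasawaAlgebraO S, e (π.cvec (r • z)) = r * h) :
    Module.Finite ℚ_[2] (TensorProduct ℤ_[2] ℚ_[2] (π.colocdQuot z)) ∧
      π.f * lamO S (IwasawaAlgebraO S ⧸ Ideal.span {h}) ≤ lamTwo 2 (π.colocdQuot z) := by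
  obtain ⟨hfin, hcount⟩ := lamTwo_colocdQuot_eq_of_column π e he z h hh hcol
  exact ⟨hfin, hcount.ge⟩

/-- **Station (DESC) as the `hDesc` binder VERBATIM** (universally in the class `z` and the column value `h`), for the glue
`IHalf_of_stations` / `katoZetaCMAtTwo_of_facts`: feed `hDesc := desc_station π e he`. [cite: Kato2004Asterisque, Thm. 12.5 (1) (p. 222)] -/
theorem desc_station [IsDiscreteValuationRing (coeffO S)] [IsAdicComplete (IsLocalRing.maximalIdeal (coeffO S)) (coeffO S)]
    (π : OnePairPins S W κ γ S₀ n ρ Θ hΘ I Sg) (e : (Fin n → PowerSeries ℤ_[2]) ≃+ IwasawaAlgebraO S)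
    (he : ∀ (r : PowerSeries ℤ_[2]) (t : Fin n → PowerSeries ℤ_[2]), e (r • t) = PowerSeries.map (padicIntToCoeffIntegers S) r * e t) :
    ∀ (z : I.H) (h : IwasawaAlgebraO S), h ≠ 0 → (∀ r : IwasawaAlgebraO S, e (π.cvec (r • z)) = r * h) →
      Module.Finite ℚ_[2] (TensorProduct ℤ_[2] ℚ_[2] (π.colocdQuot z)) ∧
        π.f * lamO S (IwasawaAlgebraO S ⧸ Ideal.span {h}) ≤ lamTwo 2 (π.colocdQuot z) :=
  fun z h hh hcol ↦ desc_of_column π e he z h hh hcol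

end Desc

end Summit.BirchSwinnertonDyer.BirchSwinnertonDyer.Theorems.ThetaTransport.TwoCurrencyDescent

end
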